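import Literature.MathematicalPhysics.QuantumFieldTheory.Balaban1983to89.B1Eq356DisplayedBounds
import Literature.MathematicalPhysics.QuantumFieldTheory.Balaban1983to89.B1Eq324GaussianMomentLeaf

/-!
# `Balaban1983to89.B1Eq324DisplayedInteractionLeaf` — T. Bałaban, *(Higgs)₂,₃ quantum fields in a finite volume. I. A lower bound*,
Commun. Math. Phys. **85** (1982) 603–626 [Balaban1982Higgs1], (3.24) p. 616 / (3.59) p. 623 with (3.56)–(3.58) p. 622: **LEAF (b) OF THE CUMULANT
EXPANSION FOR THE DISPLAYED INTERACTION `V^{(k)}` OF (3.57) ON THE PRODUCT LAW OF (3.56)** — the bridge `rv357 = poly` (the typer's slot normal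
form of (3.57) IS r14's polynomial carrier `B1Eq324GaussianMomentLeaf.poly`, definitionally) and r14's `abs_sum_cumulantOf_sub_truncExp_le_poly` with
EVERY input but `⟨χ⟩ ≥ ½` DISCHARGED on the carrier: the sub-Gaussian legs (§3/§3′ of `B1Eq357FluctuationPolynomial`), the degree bound `|J_i| ≤ n(n̄)`,
the cut-off `χ(A′)χ(φ′)` measurable in `[0,1]`, and `|V^{(k)}| ≤ B` on its support from (3.58) + (3.43)/(3.50); theorems only

statement-level skeleton of published theorems with citation tags; proofs where landed; nothing here is a claim about the Yang–Mills mass gap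

PDF held: `paper:balaban1982-cmp85-higgs23-i` (journal page = PDF page + 602); pp. 616, 622–623 [PDF 14, 20–21] re-read in the materialised text
`~/.lit/texts/paper-balaban1982-cmp85-higgs23-i/p0020.txt`, `p0021.txt`.

CITATION HEADER (lean-in-tree rule).  lit-balaban typed skeleton (HOME `run/shared/lean/pub/lit-balaban/`), unit `lit-balaban-typer` gen 33
(`literature-prover-lit-balaban-typer-g33-0`; TAKING #1 line HOME/STATUS.md 2026-08-24T20:50:40Z, part (b); free-target protocol G.5-34 (d)).  SKELETON rows **B1.Eq3.24** /
**B1.Eq3.59** (owner r12; `typed`, *"DISCHARGED MODULO NAMED LEAVES"* by p27's `B1Eq324CumulantTaylor.eq324_chi` / `cumulant359_of_leaves`) — CELLS ONLY,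
no head change.  USED BY NAME, NOTHING RESTATED: r14's `B1Eq324GaussianMomentLeaf.{poly, polyMomentBound, abs_sum_cumulantOf_sub_truncExp_le_poly}`,
`B1Eq324WeightedCumulantLeaf.leafBConst`, p36's `B10Eq24Cumulant.{nmoment, truncExp, chiMeasure}`, `Literature.Probability.LatticeModels.cumulantOf`, the
typer's `B1Eq356DisplayedBounds.coef_bound_diam_of_steiner` ((3.58) as printed ⇒ diameter currency), and
the typer's `B1Eq357FluctuationPolynomial.{law356, rv357, Idx, coefOf, slots, legRV, legParam, chi356, bound357, rv357_eq_sum_prod, card_slots_le,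
hasSubgaussianMGF_legRV, hasSubgaussianMGF_legRV_of_ineq233, measurable_chi356, chi356_nonneg, chi356_le_one, abs_rv357_le_of_chi356_ne_zero,
integral_one_sub_chi356, one_sub_integral_chi356_le}`.

THE SOURCE TEXT (verbatim; renders `…-p021-x2.png`, `…-p014-x2.png` re-read for v1.1).  p. 623 [PDF 21]: *"The properties (3.57) and (3.58) and the
properties formulated in the Propositions 2.2 and 2.3 and concerning the operators defining the basic quadratic forms of the action are sufficient for the
assumptions made in the lemma [2]. … Using the lemma we get (3.56) = ⟨χ(A′)χ(φ′)exp(V^{(k)})⟩ = exp[Σ_{n=1}^{n̄} (1/n!)⟨(V^{(k)})ⁿ⟩^T + O(1)(L^kε)^κ|T₁^{(k)}|],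
κ > d. (3.59)"*; p. 616 [PDF 14]: *"⟨χ exp(V)⟩ = exp[⟨V⟩ + (1/2!)⟨V²⟩^T + … + (1/n̄!)⟨V^{n̄}⟩^T + O(ε^κ)|T₁|], κ > d. (3.24)"*, where (p. 616) *"⟨Vⁿ⟩^T denotes
the truncated expectation of a product of n polynomials V"* — in the tree p36's `truncExp` / the cumulants `cumulantOf (nmoment V μ)` of r14's chain.
v1.1 (typer gen 33, DOCSTRING-ONLY, every declaration byte-identical to v1 = p392998 ✓ d0b8863819cb): the v1 header rendered (3.59)/(3.24) with the
truncated expectations written as «⟨V; …; V⟩^T» paraphrases under a *verbatim* label — replaced by the printed text above (cf. ref-4 g109 D-g109-1 on the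
sibling `B1Eq356DisplayedBounds`).

WHAT IS PROVED (kernel-checked, 0 `sorry`, standard axioms; theorems only).
 * `rv357_eq_poly` — the typer's random variable `V^{(k)}` on the product space IS r14's `poly Finset.univ slots coefOf legRV`.
 * **`leafB_displayed`** — for the displayed `V^{(k)}` (kernels `coef` obeying (3.58) in the diameter currency with `A₀ = O(1)(L^kε)^{κ₀}`, threshold
   `t ≥ 0` of (3.43)/(3.50), a common variance bound `σ²`): `|Σ_{n=1}^{n̄} (κₙ(⟨(V^{(k)})^·⟩) − ⟨(V^{(k)})ⁿ⟩ᵀ_{χ})/n!| ≤ leafBConst n̄ M · √(∫(1 − χ(A′)χ(φ′)))`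
   under `law356`, `M = polyMomentBound Finset.univ coefOf qmax n̄ (legParam P k σ²)`, the ONLY remaining input being `⟨χ(A′)χ(φ′)⟩ ≥ ½`.
 * **`leafB_displayed_of_ineq233`** — the same with Prop. 2.3 (2.33) (lower halves) as the displayed input: parameter `γ₀⁻¹`.
 * **`leafB_displayed_tails`** — the right side bounded by `leafBConst n̄ M · √(τ_A + τ_φ)`, `τ` the two one-factor small-field tails of
   `B1Eq324SmallFieldLeaf` (so that leaf (b) for the displayed `V^{(k)}` is `O(√τ)` with `τ` the Gaussian tails of leaf (a)).
 * **`leafB_displayed_printed`** — `leafB_displayed_tails` with (3.58) in the PRINTED currency (Steiner tree length) as the hypothesis.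
HONEST SCOPE.  (3.57)/(3.58) and (2.33) are DISPLAYED hypotheses (Prop. 3.2 is paper III's Prop. 1; Prop. 2.3 is row B1.Prop2.3); `⟨χ⟩ ≥ ½` is kept as
the hypothesis `hZ` (leaf-(a) data: `B1Eq357FluctuationPolynomial.half_le_integral_chi356` reduces it to the two tails `≤ ¼`); the constants are r14's
crude ones; leaf (c) (the lemma of [2] p. 152, NOT HELD) untouched; rows B1.Eq3.24 / B1.Eq3.59 keep their heads; NOT summit progress; NOT Clay.
-/

open scoped BigOperators NNReal Nat
open _root_.MeasureTheory _root_.ProbabilityTheory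

namespace Literature.MathematicalPhysics.QuantumFieldTheory.Balaban1983to89.B1Eq324DisplayedInteractionLeaf

open HiggsLattice (ChargeData siteInner)
open HiggsFluctMeasure (fluctMeasure precOp)
open B1Eq230FluctCov (precOpA)
open HiggsCondGauss228 (condGauss fieldOfCrd)
open B1Eq343FluctuationChi (chiFluctA chiFluctφ)
open B1Ineq358TreeDecaySum (diam)
open B3Ineq213 (treeLen)
open B1Eq356DisplayedBounds (coef_bound_diam_of_steiner)
open B1Prop32InteractionBound (Leg)
open B1Eq324SmallFieldLeaf (bondVar siteVar)
open Literature.Probability.LatticeModels (cumulantOf)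
open B10Eq24Cumulant (nmoment truncExp chiMeasure)
open B1Eq324WeightedCumulantLeaf (leafBConst leafBConst_nonneg)
open B1Eq324GaussianMomentLeaf (poly polyMomentBound one_le_polyMomentBound abs_sum_cumulantOf_sub_truncExp_le_poly)
open B1Eq357FluctuationPolynomial

noncomputable section

variable {P : HiggsLattice.Params} {N : ℕ}
  (C : ChargeData N) (Ω : Finset (HiggsLattice.Site P 0)) (B : HiggsLattice.VecField P 0)

/-! ## The bridge and leaf (b) for the displayed `V^{(k)}` -/

/-- **THE DISPLAYED `V^{(k)}` IS r14's POLYNOMIAL CARRIER**: `rv357 k qmax coef = poly Finset.univ slots coefOf legRV` (the typer's slot normal form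
`B1Eq357FluctuationPolynomial.rv357_eq_sum_prod`). [cite: Balaban1982Higgs1, Prop. 3.2 (3.57) p.622; (3.24) p.616] -/
theorem rv357_eq_poly (k qmax : ℕ) (coef : (q : ℕ) → (Fin q → HiggsLattice.Site P k) → (Fin q → Leg N P.d) → ℝ) :
    rv357 (P := P) (N := N) k qmax coef = poly Finset.univ (slots k qmax) (coefOf k qmax coef) (legRV k qmax) := by
  funext ω
  rw [poly]
  exact rv357_eq_sum_prod k qmax coef ω

/-- **LEAF (b) OF (3.24)/(3.59) FOR THE DISPLAYED INTERACTION `V^{(k)}` OF (3.57) ON THE PRODUCT LAW OF (3.56)**: with the kernels obeying (3.58)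
(diameter currency, `A₀ = O(1)(L^kε)^{κ₀}`), the cut-off threshold `t ≥ 0`, a common bound `σ²` of the covariance diagonals, and `⟨χ(A′)χ(φ′)⟩ ≥ ½`:
`|Σ_{n=1}^{n̄} (κₙ(⟨(V^{(k)})^·⟩_{law356}) − ⟨(V^{(k)})ⁿ⟩ᵀ_{χ·law356})/n!| ≤ leafBConst n̄ M · √(∫ (1 − χ(A′)χ(φ′)) d law356)`,
`M = polyMomentBound univ coefOf qmax n̄ (legParam P k σ²)` — r14's `abs_sum_cumulantOf_sub_truncExp_le_poly` with `h` (sub-Gaussian legs), `hq`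
(degree), `hχ*` (cut-off) and `hVB` (`|V| ≤ bound357` on the support) DISCHARGED by `B1Eq357FluctuationPolynomial` (`μ₀², m² > 0`, `a > 0`, `L > 1`,
`k ≤ K`). [cite: Balaban1982Higgs1, (3.24) p.616; (3.59) p.623; Prop. 3.2 (3.57)–(3.58) p.622] -/
theorem leafB_displayed {μ0sq msq a : ℝ} (hμ : 0 < μ0sq) (hmsq : 0 < msq) (ha : 0 < a) (hL : 1 < (P.L : ℝ)) {k : ℕ} (hk : k ≤ P.K)
    {σsq : ℝ} (hσA : ∀ b : HiggsLattice.PBond P k, bondVar P μ0sq a k b ≤ σsq)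
    (hσφ : ∀ (y : HiggsLattice.Site P k) (i : Fin N), siteVar P C Ω B msq a k Finset.univ y i ≤ σsq)
    (qmax : ℕ) (coef : (q : ℕ) → (Fin q → HiggsLattice.Site P k) → (Fin q → Leg N P.d) → ℝ)
    {A₀ δ₀ t : ℝ} (hA₀ : 0 ≤ A₀) (hδ₀ : 0 < δ₀) (ht : 0 ≤ t)
    (h358 : ∀ q, q ≤ qmax → ∀ (z : Fin q → HiggsLattice.Site P k) (κ : Fin q → Leg N P.d),
      |coef q z κ| ≤ A₀ * Real.exp (-(δ₀ * (diam z : ℝ))))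
    (hZ : 1 / 2 ≤ ∫ ω, chi356 (P := P) (N := N) k t ω ∂(law356 C Ω B μ0sq msq a k)) (nbar : ℕ) :
    |∑ n ∈ Finset.Icc 1 nbar,
        (cumulantOf (nmoment (rv357 k qmax coef) (law356 C Ω B μ0sq msq a k)) n
          - truncExp (rv357 k qmax coef) (chiMeasure (law356 C Ω B μ0sq msq a k) (chi356 k t)) n) / (n ! : ℝ)|
      ≤ leafBConst nbar (polyMomentBound Finset.univ (coefOf k qmax coef) qmax nbar (legParam P k σsq))
        * Real.sqrt (∫ ω, (1 - chi356 (P := P) (N := N) k t ω) ∂(law356 C Ω B μ0sq msq a k)) := by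
  haveI := isProbabilityMeasure_law356 C Ω B hμ hmsq ha hL hk
  rw [rv357_eq_poly]
  exact abs_sum_cumulantOf_sub_truncExp_le_poly (hasSubgaussianMGF_legRV C Ω B hμ hmsq ha hL hk hσA hσφ qmax)
    (fun i _ => card_slots_le k qmax i) (measurable_chi356 k t) (chi356_nonneg k t) (chi356_le_one k t) hZ
    (fun ω hω => by rw [← rv357_eq_poly]; exact abs_rv357_le_of_chi356_ne_zero k qmax coef hA₀ hδ₀ ht h358 ω hω) nbar

/-- **THE SAME WITH PROPOSITION 2.3 (2.33) AS THE DISPLAYED INPUT** (its lower halves for the vector and the conditional scalar fluctuation operators):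
the moment constant is `polyMomentBound univ coefOf qmax n̄ γ₀⁻¹` — independent of `k` and `ε` but through `Σ_i|coefOf i|`
(`B1Eq357FluctuationPolynomial.sum_abs_coefOf_le`: `≤ O(1)(L^kε)^{κ₀}|T^{(k)}|·polyConst`). [cite: Balaban1982Higgs1, (3.24) p.616; (3.59) p.623; (2.33) p.611] -/
theorem leafB_displayed_of_ineq233 {μ0sq msq a : ℝ} (hμ : 0 < μ0sq) (hmsq : 0 < msq) (ha : 0 < a) (hL : 1 < (P.L : ℝ))
    {k : ℕ} (hk : k ≤ P.K) {γ₀ : ℝ} (hγ : 0 < γ₀)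
    (h233A : ∀ f : HiggsLattice.ScalarField P k P.d, γ₀ * (P.mesh k)⁻¹ ^ 2 * siteInner f f ≤ siteInner f (precOp P μ0sq a k f))
    (h233φ : ∀ f : HiggsLattice.ScalarField P k N, γ₀ * (P.mesh k)⁻¹ ^ 2 * siteInner f f ≤ siteInner f (precOpA C Ω B msq a k f))
    (qmax : ℕ) (coef : (q : ℕ) → (Fin q → HiggsLattice.Site P k) → (Fin q → Leg N P.d) → ℝ)
    {A₀ δ₀ t : ℝ} (hA₀ : 0 ≤ A₀) (hδ₀ : 0 < δ₀) (ht : 0 ≤ t)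
    (h358 : ∀ q, q ≤ qmax → ∀ (z : Fin q → HiggsLattice.Site P k) (κ : Fin q → Leg N P.d),
      |coef q z κ| ≤ A₀ * Real.exp (-(δ₀ * (diam z : ℝ))))
    (hZ : 1 / 2 ≤ ∫ ω, chi356 (P := P) (N := N) k t ω ∂(law356 C Ω B μ0sq msq a k)) (nbar : ℕ) :
    |∑ n ∈ Finset.Icc 1 nbar,
        (cumulantOf (nmoment (rv357 k qmax coef) (law356 C Ω B μ0sq msq a k)) n
          - truncExp (rv357 k qmax coef) (chiMeasure (law356 C Ω B μ0sq msq a k) (chi356 k t)) n) / (n ! : ℝ)|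
      ≤ leafBConst nbar (polyMomentBound Finset.univ (coefOf k qmax coef) qmax nbar (γ₀⁻¹).toNNReal)
        * Real.sqrt (∫ ω, (1 - chi356 (P := P) (N := N) k t ω) ∂(law356 C Ω B μ0sq msq a k)) := by
  haveI := isProbabilityMeasure_law356 C Ω B hμ hmsq ha hL hk
  rw [rv357_eq_poly]
  exact abs_sum_cumulantOf_sub_truncExp_le_poly (hasSubgaussianMGF_legRV_of_ineq233 C Ω B hμ hmsq ha hL hk hγ h233A h233φ qmax)
    (fun i _ => card_slots_le k qmax i) (measurable_chi356 k t) (chi356_nonneg k t) (chi356_le_one k t) hZ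
    (fun ω hω => by rw [← rv357_eq_poly]; exact abs_rv357_le_of_chi356_ne_zero k qmax coef hA₀ hδ₀ ht h358 ω hω) nbar

/-- **LEAF (b) FOR THE DISPLAYED `V^{(k)}` IN TERMS OF THE TWO ONE-FACTOR TAILS**: the right side of `leafB_displayed` is at most
`leafBConst n̄ M · √(τ_A + τ_φ)`, `τ_A = 1 − ⟨χ(A′)⟩`, `τ_φ = 1 − ⟨χ(φ′)⟩` (`B1Eq357FluctuationPolynomial.integral_one_sub_chi356`,
`one_sub_integral_chi356_le`; the tails themselves are `≤ 2d|T^{(k)}|e^{−t²/(2dσ²)}`, `≤ 2N|T^{(k)}|e^{−t²/(2Nσ²)}` by `B1Eq324SmallFieldLeaf`).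
[cite: Balaban1982Higgs1, (3.24) p.616; (3.59) p.623; (3.56) p.622] -/
theorem leafB_displayed_tails {μ0sq msq a : ℝ} (hμ : 0 < μ0sq) (hmsq : 0 < msq) (ha : 0 < a) (hL : 1 < (P.L : ℝ)) {k : ℕ} (hk : k ≤ P.K)
    {σsq : ℝ} (hσA : ∀ b : HiggsLattice.PBond P k, bondVar P μ0sq a k b ≤ σsq)
    (hσφ : ∀ (y : HiggsLattice.Site P k) (i : Fin N), siteVar P C Ω B msq a k Finset.univ y i ≤ σsq)
    (qmax : ℕ) (coef : (q : ℕ) → (Fin q → HiggsLattice.Site P k) → (Fin q → Leg N P.d) → ℝ)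
    {A₀ δ₀ t : ℝ} (hA₀ : 0 ≤ A₀) (hδ₀ : 0 < δ₀) (ht : 0 ≤ t)
    (h358 : ∀ q, q ≤ qmax → ∀ (z : Fin q → HiggsLattice.Site P k) (κ : Fin q → Leg N P.d),
      |coef q z κ| ≤ A₀ * Real.exp (-(δ₀ * (diam z : ℝ))))
    (hZ : 1 / 2 ≤ ∫ ω, chi356 (P := P) (N := N) k t ω ∂(law356 C Ω B μ0sq msq a k)) (nbar : ℕ) :
    |∑ n ∈ Finset.Icc 1 nbar,
        (cumulantOf (nmoment (rv357 k qmax coef) (law356 C Ω B μ0sq msq a k)) n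
          - truncExp (rv357 k qmax coef) (chiMeasure (law356 C Ω B μ0sq msq a k) (chi356 k t)) n) / (n ! : ℝ)|
      ≤ leafBConst nbar (polyMomentBound Finset.univ (coefOf k qmax coef) qmax nbar (legParam P k σsq))
        * Real.sqrt ((1 - ∫ A', chiFluctA t A' ∂(fluctMeasure P μ0sq a k))
            + (1 - ∫ x, chiFluctφ t (fieldOfCrd (Finset.univ : Finset (HiggsLattice.Site P k)) x)
                ∂(condGauss C Ω B msq a k (Finset.univ : Finset (HiggsLattice.Site P k))))) := by
  refine (leafB_displayed C Ω B hμ hmsq ha hL hk hσA hσφ qmax coef hA₀ hδ₀ ht h358 hZ nbar).trans ?_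
  refine mul_le_mul_of_nonneg_left (Real.sqrt_le_sqrt ?_)
    (leafBConst_nonneg nbar (zero_le_one.trans (one_le_polyMomentBound _ _ _ _ _)))
  rw [integral_one_sub_chi356 C Ω B hμ hmsq ha hL hk t]
  exact one_sub_integral_chi356_le C Ω B hμ hmsq ha hL hk t

/-- **LEAF (b) FOR THE DISPLAYED `V^{(k)}` WITH (3.58) IN THE PRINTED CURRENCY** (decay in the length of the shortest graph connecting the argument
points, Steiner vertices allowed): `leafB_displayed_tails` ∘ `coef_bound_diam_of_steiner`. [cite: Balaban1982Higgs1, (3.24) p.616; (3.59) p.623; Prop. 3.2 (3.57)–(3.58) p.622] -/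
theorem leafB_displayed_printed {μ0sq msq a : ℝ} (hμ : 0 < μ0sq) (hmsq : 0 < msq) (ha : 0 < a) (hL : 1 < (P.L : ℝ)) {k : ℕ} (hk : k ≤ P.K)
    {σsq : ℝ} (hσA : ∀ b : HiggsLattice.PBond P k, bondVar P μ0sq a k b ≤ σsq)
    (hσφ : ∀ (y : HiggsLattice.Site P k) (i : Fin N), siteVar P C Ω B msq a k Finset.univ y i ≤ σsq)
    (qmax : ℕ) (coef : (q : ℕ) → (Fin q → HiggsLattice.Site P k) → (Fin q → Leg N P.d) → ℝ)
    {A₀ δ₀ t : ℝ} (hA₀ : 0 ≤ A₀) (hδ₀ : 0 < δ₀) (ht : 0 ≤ t)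
    (h358 : ∀ q, q ≤ qmax → ∀ (z : Fin q → HiggsLattice.Site P k) (κ : Fin q → Leg N P.d), ∃ (n : ℕ) (w : Fin n → HiggsLattice.Site P k),
      |coef q z κ| ≤ A₀ * Real.exp (-(δ₀ * treeLen (fun a b : Fin q ⊕ Fin n =>
        (HiggsLattice.Site.tdist (Sum.elim z w a) (Sum.elim z w b) : ℝ)))))
    (hZ : 1 / 2 ≤ ∫ ω, chi356 (P := P) (N := N) k t ω ∂(law356 C Ω B μ0sq msq a k)) (nbar : ℕ) :
    |∑ n ∈ Finset.Icc 1 nbar,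
        (cumulantOf (nmoment (rv357 k qmax coef) (law356 C Ω B μ0sq msq a k)) n
          - truncExp (rv357 k qmax coef) (chiMeasure (law356 C Ω B μ0sq msq a k) (chi356 k t)) n) / (n ! : ℝ)|
      ≤ leafBConst nbar (polyMomentBound Finset.univ (coefOf k qmax coef) qmax nbar (legParam P k σsq))
        * Real.sqrt ((1 - ∫ A', chiFluctA t A' ∂(fluctMeasure P μ0sq a k))
            + (1 - ∫ x, chiFluctφ t (fieldOfCrd (Finset.univ : Finset (HiggsLattice.Site P k)) x)
                ∂(condGauss C Ω B msq a k (Finset.univ : Finset (HiggsLattice.Site P k))))) :=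
  leafB_displayed_tails C Ω B hμ hmsq ha hL hk hσA hσφ qmax coef hA₀ hδ₀ ht (coef_bound_diam_of_steiner hA₀ hδ₀.le h358) hZ nbar

end

end Literature.MathematicalPhysics.QuantumFieldTheory.Balaban1983to89.B1Eq324DisplayedInteractionLeaf
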